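import Mathlib

/-!
# A count of double cosets from a count of invariant values with bounded fibres (support, seat p1)

The `count_bound` field of `T7SupportDominantGeometricSide.DominantSide` counts DOUBLE COSETS of bounded size;
the arithmetic counts (t7-L1-p5's `CountBoundOfKappa`, t7-x1's box counts) count VALUES of the invariant `κ`.
They are linked by the fibres of `γ ↦ κ(γ)`: one double coset per regular value (`T7SupportTwoTorusInvariant`,
`hκ : Injective κ` in `CountBoundOfKappa`) — or, in general, BOUNDED fibres with a multiplicity constant `m`
(t7-crit-2's record, STATUS l. 15064 (iv) / l. 15131 (3)). This file is the bounded-fibre version: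

  if every fibre of `κ` over the relevant set has at most `m` elements, a finite set `t` of values with
  `|t| ≤ C′ (1 + R)^β` gives a finite set `s` of orbits with `|s| ≤ m · C′ (1 + R)^β`
  (`exists_finset_of_fibre_bound`, `count_bound_of_kappa_count`) — VERBATIM the `count_bound` field, with the
  constant `m C′`.

Nothing here is about any group, any invariant, or any period.
Blind lane: Mathlib only; no sorry; axioms ⊆ {propext, Classical.choice, Quot.sound}.
-/

namespace Summit.Ventures.HodgeRepro2.T7SupportBoundedFibreCount

open Finset

variable {Orb K : Type*}

/-- the fibre of `κ` over `b` inside `A` -/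
def fibre (κ : Orb → K) (A : Set Orb) (b : K) : Set Orb := {γ | γ ∈ A ∧ κ γ = b}

/-- **the orbits over a finite set of values form a finite set of size `≤ m · |t|`** when the fibres inside `A`
are finite with at most `m` elements -/
theorem exists_finset_of_fibre_bound (κ : Orb → K) (A : Set Orb) (hfin : ∀ b, (fibre κ A b).Finite) (t : Finset K)
    (m : ℕ) (hm : ∀ b ∈ t, (fibre κ A b).ncard ≤ m) :
    ∃ s : Finset Orb, (∀ γ ∈ A, κ γ ∈ t → γ ∈ s) ∧ s.card ≤ m * t.card := by
  classical
  refine ⟨t.biUnion fun b => (hfin b).toFinset, fun γ hγA hγt => ?_, ?_⟩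
  · rw [mem_biUnion]
    exact ⟨κ γ, hγt, by rw [Set.Finite.mem_toFinset]; exact ⟨hγA, rfl⟩⟩
  · calc (t.biUnion fun b => (hfin b).toFinset).card ≤ ∑ b ∈ t, ((hfin b).toFinset).card :=
          card_biUnion_le
      _ ≤ t.card • m := by
          refine sum_le_card_nsmul _ _ _ fun b hb => ?_
          rw [← Set.ncard_eq_toFinset_card _ (hfin b)]
          exact hm b hb
      _ = m * t.card := by rw [smul_eq_mul, mul_comm]

/-- **the `count_bound` field from a count of `κ`-values with bounded fibres**: for every level `N` and `R ≥ 0`,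
a finite set of values `t` containing `κ γ` for every relevant `γ` of size `≤ R`, with `|t| ≤ C′ (1 + R)^β`, and
fibres of at most `m` elements, give a finite set of orbits containing every relevant `γ` of size `≤ R`, of
cardinality `≤ (m C′) (1 + R)^β`. -/
theorem count_bound_of_kappa_count [DecidableEq K] (κ : Orb → K) (size : Orb → ℝ) (arith : ℕ → Orb → Prop) (m : ℕ)
    (hfin : ∀ N b, (fibre κ {γ | arith N γ} b).Finite)
    (hm : ∀ N b, (fibre κ {γ | arith N γ} b).ncard ≤ m) {C' β : ℝ}
    (hvals : ∀ N (R : ℝ), 0 ≤ R → ∃ t : Finset K,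
      (∀ γ, arith N γ → size γ ≤ R → κ γ ∈ t) ∧ (t.card : ℝ) ≤ C' * (1 + R) ^ β) :
    ∃ C'' : ℝ, ∀ N (R : ℝ), 0 ≤ R → ∃ s : Finset Orb,
      (∀ γ, arith N γ → size γ ≤ R → γ ∈ s) ∧ (s.card : ℝ) ≤ C'' * (1 + R) ^ β := by
  refine ⟨(m : ℝ) * C', fun N R hR => ?_⟩
  obtain ⟨t, ht, htc⟩ := hvals N R hR
  obtain ⟨s, hs, hsc⟩ := exists_finset_of_fibre_bound κ {γ | arith N γ} (hfin N) t m fun b _ => hm N b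
  refine ⟨s, fun γ hγ hγR => hs γ hγ (ht γ hγ hγR), ?_⟩
  calc (s.card : ℝ) ≤ (m : ℝ) * t.card := by exact_mod_cast hsc
    _ ≤ (m : ℝ) * (C' * (1 + R) ^ β) := by gcongr
    _ = (m : ℝ) * C' * (1 + R) ^ β := by ring

/-- the fibres of an injective `κ` are subsingletons -/
theorem fibre_subsingleton_of_injective (κ : Orb → K) (A : Set Orb) (hκ : Function.Injective κ) (b : K) :
    (fibre κ A b).Subsingleton := fun _ hγ _ hγ' => hκ (hγ.2.trans hγ'.2.symm)

/-- the fibres of an injective `κ` are finite -/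
theorem fibre_finite_of_injective (κ : Orb → K) (A : Set Orb) (hκ : Function.Injective κ) (b : K) :
    (fibre κ A b).Finite :=
  (fibre_subsingleton_of_injective κ A hκ b).finite

/-- the injective case is the case `m = 1` -/
theorem fibre_ncard_le_one_of_injective (κ : Orb → K) (A : Set Orb) (hκ : Function.Injective κ) (b : K) :
    (fibre κ A b).ncard ≤ 1 :=
  (Set.ncard_le_one_iff (fibre_finite_of_injective κ A hκ b)).2 fun hγ hγ' =>
    fibre_subsingleton_of_injective κ A hκ b hγ hγ'

end Summit.Ventures.HodgeRepro2.T7SupportBoundedFibreCount
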